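import Literature.Probability.RandomPlanarGeometry.BoundaryCorrespondence
import Literature.Probability.RandomPlanarGeometry.ConformalRestrictionProofs
import Literature.Probability.RandomPlanarGeometry.EllipseHulls
import Literature.Probability.RandomPlanarGeometry.RestrictionHulls
import HarnessLib

/-!
# Chordal SLE_{8/3} misses a ball with positive probability (from [LSW] Theorem 6.1)

Topic `Literature/Probability/RandomPlanarGeometry`. One proved consequence of the conformal
restriction formula of G. F. Lawler, O. Schramm, W. Werner, *Conformal restriction: the chordal
case*, J. Amer. Math. Soc. 16 (2003) 917–955 (arXiv:math/0209343), **Theorem 6.1** (p. 23: "Let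
`γ` be the SLE_{8/3} path starting at the origin and `A ∈ 𝒬*`, then
`P[γ[0, ∞) ∩ A = ∅] = Φ'_A(0)^{5/8}`"), vendored verbatim in the tree as the named fact
`Literature.Probability.RandomPlanarGeometry.sle_restriction_eightThirds` (`RestrictionHulls.lean`):

* `Literature.Probability.RandomPlanarGeometry.measure_disjoint_sleTrace_ellHull_ne_zero` — the SLE_{8/3} trace avoids the half-ellipse
  hull `B(2, 6; 1/2)` of `EllipseHulls.lean` (a `*`-hull with explicit restriction map and
  `Φ'_B(0) = ellDeriv 2 6 (1/2) > 0`) with positive pre-Wiener probability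
  (`= Φ'_B(0)^{5/8} > 0`);
* `Literature.Probability.RandomPlanarGeometry.IsSLECurve.exists_ball_measure_disjoint_ne_zero` — **for every Dobrushin domain
  `(D; a, b)` and every chordal SLE_{8/3} random curve `Γ` of `D`, there is a ball `B(z, r) ⊆ D`
  such that `Γ` misses `B(z, 2r)` with positive pre-Wiener probability.** Proof: the hull `B`
  contains the half-plane ball `V = B(4 + i/5, 1/10) ⊆ ℍ`; under a chordal uniformizing map `φ`
  of `D` the set `{w ∈ D | φ⁻¹ w ∈ V}` is open and contains a ball about `φ(4 + i/5)`; on the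
  event `γ ∩ B = ∅`, off the null set where the trace fails to be simple (Rohde–Schramm, Thm 6.1:
  `γ(t) ∈ ℍ` for `t > 0`, the named fact `Literature.Probability.RandomPlanarGeometry.ae_isSimpleTrace_sleTrace_of_le_four`), the
  compactified image `Γ = φ(γ) ∪ {b}` has no point `w` in that ball (such a `w = φ(γ t)`, `t > 0`,
  would give `γ t = φ⁻¹ w ∈ V ⊆ B`; the endpoints `a, b ∉ D`).

This is the continuum input of the barrier mechanism
`Literature/Barriers/CriticalPhenomena/SupercriticalSAWSpaceFillingProofs.lean`
(`IsSpaceFillingFamily.not_convergesInLawToSLE`: a space-filling family of lattice curves cannot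
converge in law to a random curve missing a ball with positive probability).

Mathlib: `ContinuousOn.isOpen_inter_preimage`, `Metric.isOpen_iff`, `measure_mono_null_ae`,
`ENNReal.ofReal_pos`, `Real.rpow_pos_of_pos`, `Complex.dist_of_re_eq`, `Complex.abs_im_le_norm`.

## References

* G. F. Lawler, O. Schramm, W. Werner, *Conformal restriction: the chordal case*, J. Amer. Math.
  Soc. 16 (2003) 917–955, Thm. 6.1 (p. 23). [LawlerSchrammWerner2003Restriction]
* S. Rohde, O. Schramm, *Basic properties of SLE*, Ann. of Math. 161 (2005) 883–924, Thm. 6.1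
  (the trace is a simple path in `ℍ ∪ {0}` for `κ ≤ 4`). [RohdeSchramm2005]
-/

noncomputable section

open MeasureTheory Filter Topology Metric Set Complex
open UpperHalfPlane (upperHalfPlaneSet isOpen_upperHalfPlaneSet)
open scoped ENNReal NNReal unitInterval

namespace Literature.Probability.RandomPlanarGeometry

/-! ### A half-plane ball inside the half-ellipse hull `B(2, 6; 1/2)` -/

/-- The condition `h · (ρ + ρ⁻¹) < c` of `EllipseHulls` for `(a, b, ρ) = (2, 6, 1/2)`:
`1 · 5/2 < 4`. [folklore] -/
theorem ellH_mul_jLevel_lt_two_six_half : ellH 2 6 * jLevel (1 / 2) < ellC 2 6 := by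
  norm_num [ellH, ellC, jLevel]

/-- The centre `4 + i/5` of the test ball. [folklore] -/
def sleTestCentre : ℂ := ⟨4, 1 / 5⟩

/-- The test ball `B(4 + i/5, 1/10)` lies in the open upper half-plane. [folklore] -/
theorem ball_sleTestCentre_subset_upperHalfPlaneSet :
    ball sleTestCentre (1 / 10) ⊆ upperHalfPlaneSet := by
  intro w hw
  rw [mem_ball, Complex.dist_eq] at hw
  have h := (Complex.abs_im_le_norm (w - sleTestCentre)).trans_lt hw
  rw [Complex.sub_im, show sleTestCentre.im = 1 / 5 from rfl, abs_lt] at h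
  show 0 < w.im
  linarith [h.1]

/-- The test ball `B(4 + i/5, 1/10)` lies in the half-ellipse hull `B(2, 6; 1/2)` (its points are
within `3/10 < 1/2 = h(ρ + ρ⁻¹ - 2)` of `[2, 6]`, `EllipseHulls.mem_ellRegion_of_infDist_lt`).
[folklore] -/
theorem ball_sleTestCentre_subset_ellHull : ball sleTestCentre (1 / 10) ⊆ ellHull 2 6 (1 / 2) := by
  intro w hw
  have him : 0 < w.im := ball_sleTestCentre_subset_upperHalfPlaneSet hw
  have h4 : ((4 : ℝ) : ℂ) ∈ realSeg 2 6 := ofReal_mem_realSeg.2 (by norm_num [uIcc_of_le])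
  have hdist : infDist w (realSeg 2 6) < 1 / 2 := by
    refine (infDist_le_dist_of_mem h4).trans_lt ?_
    have h1 : dist w ((4 : ℝ) : ℂ) ≤ dist w sleTestCentre + dist sleTestCentre ((4 : ℝ) : ℂ) :=
      dist_triangle _ _ _
    have h2 : dist sleTestCentre ((4 : ℝ) : ℂ) = 1 / 5 := by
      rw [Complex.dist_of_re_eq (by simp [sleTestCentre]), show sleTestCentre.im = 1 / 5 from rfl,
        Complex.ofReal_im, Real.dist_eq]
      norm_num
    rw [mem_ball] at hw
    linarith
  have hreg : w ∈ ellRegion 2 6 (1 / 2) :=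
    mem_ellRegion_of_infDist_lt (by norm_num) (le_of_eq (by norm_num [ellH, jLevel])) hdist
  show w ∈ ellRegion 2 6 (1 / 2) ∩ {z : ℂ | 0 ≤ z.im}
  exact ⟨hreg, him.le⟩

/-! ### The SLE_{8/3} trace avoids `B(2, 6; 1/2)` with positive probability -/

/-- **[LSW] Theorem 6.1 applied to the half-ellipse hull `B = B(2, 6; 1/2)`**: the SLE_{8/3} trace
avoids `B` with pre-Wiener probability `Φ'_B(0)^{5/8}`, `Φ'_B(0) = ellDeriv 2 6 (1/2) ∈ (0, 1]`
(`isStarHull_ellHull`, `isRestrictionMap_ellConf`, `hasRestrictionDeriv_ellConf`), hence with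
positive probability. [cite: LawlerSchrammWerner2003Restriction, Thm. 6.1] -/
theorem measure_disjoint_sleTrace_ellHull_ne_zero (h61 : sle_restriction_eightThirds) :
    Process.preWienerMeasure {ω | Disjoint (range (sleTrace ((8 : ℝ≥0) / 3) ω)) (ellHull 2 6 (1 / 2))} ≠ 0 := by
  have hab : (2 : ℝ) < 6 := by norm_num
  have h0 : (0 : ℝ) < 1 / 2 := by norm_num
  have h1 : (1 / 2 : ℝ) < 1 := by norm_num
  have hB := ellH_mul_jLevel_lt_two_six_half
  rw [h61 (isStarHull_ellHull hab h0 h1 hB) (isRestrictionMap_ellConf hab h0 h1 hB)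
    (hasRestrictionDeriv_ellConf hab h0 h1 hB)]
  exact (ENNReal.ofReal_pos.2 (Real.rpow_pos_of_pos (ellDeriv_pos_le hab h0 h1.le hB).1 _)).ne'

/-! ### Transfer to a Dobrushin domain -/

/-- **Chordal SLE_{8/3} misses a ball with positive probability.** For every Dobrushin domain
`(D; a, b)` and every chordal SLE_{8/3} random curve `Γ` of `D` (`Literature.Probability.RandomPlanarGeometry.IsSLECurve`), there are
`z ∈ D` and `r > 0` with `B(z, r) ⊆ D` such that the trace of `Γ` is disjoint from `B(z, 2r)`
with positive pre-Wiener probability. From [LSW] Thm. 6.1 for the hull `B(2, 6; 1/2)`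
(`measure_disjoint_sleTrace_ellHull_ne_zero`, hypothesis `h61`) and the simplicity of the
SLE_κ trace for `κ ≤ 4` (Rohde–Schramm 2005, Thm. 6.1: `γ(t) ∈ ℍ` for `t > 0`; hypothesis `h₆`),
by transporting the half-plane ball `B(4 + i/5, 1/10) ⊆ B(2, 6; 1/2)` with the chordal
uniformizing map of `Γ`. [cite: LawlerSchrammWerner2003Restriction, Thm. 6.1] -/
theorem IsSLECurve.exists_ball_measure_disjoint_ne_zero (h61 : sle_restriction_eightThirds)
    (h₆ : RandomPlanarGeometry.ae_isSimpleTrace_sleTrace_of_le_four (κ := (8 : ℝ≥0) / 3))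
    {D : DobrushinDomain} {Γ : (ℝ≥0 → ℝ) → CurveClass ℂ} (hΓ : IsSLECurve ((8 : ℝ≥0) / 3) D Γ) :
    ∃ z : ℂ, ∃ r : ℝ, 0 < r ∧ ball z r ⊆ D.carrier ∧
      Process.preWienerMeasure {ω | Disjoint (ball z (2 * r)) (Γ ω).range} ≠ 0 := by
  obtain ⟨-, φ, hφ, hae⟩ := hΓ
  set V : Set ℂ := ball sleTestCentre (1 / 10) with hV
  have hVH : V ⊆ upperHalfPlaneSet := ball_sleTestCentre_subset_upperHalfPlaneSet
  have hVA : V ⊆ ellHull 2 6 (1 / 2) := ball_sleTestCentre_subset_ellHull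
  -- the open set `{w ∈ D | φ⁻¹ w ∈ V}` and a ball in it about `φ (4 + i/5)`
  set S : Set ℂ := D.carrier ∩ φ.symm ⁻¹' V with hS
  have hSopen : IsOpen S := φ.symm.continuousOn.isOpen_inter_preimage D.isOpen isOpen_ball
  have hv₀ : sleTestCentre ∈ upperHalfPlaneSet := hVH (mem_ball_self (by norm_num))
  have hz₀ : φ sleTestCentre ∈ S :=
    ⟨φ.mapsTo hv₀, by
      show φ.symm (φ sleTestCentre) ∈ V
      rw [φ.symm_apply_apply hv₀]
      exact mem_ball_self (by norm_num)⟩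
  obtain ⟨R, hR, hRS⟩ := Metric.isOpen_iff.1 hSopen _ hz₀
  refine ⟨φ sleTestCentre, R / 3, by positivity, ?_, ?_⟩
  · exact (ball_subset_ball (by linarith)).trans (hRS.trans inter_subset_left)
  · -- the avoidance event of the hull is a.s. contained in the avoidance event of the ball
    have h8 : (0 : ℝ≥0) < (8 : ℝ≥0) / 3 := by positivity
    have h8' : (8 : ℝ≥0) / 3 ≤ 4 := by
      rw [div_le_iff₀ (by norm_num : (0 : ℝ≥0) < 3)]
      norm_num
    have key : {ω | Disjoint (range (sleTrace ((8 : ℝ≥0) / 3) ω)) (ellHull 2 6 (1 / 2))} ≤ᵐ[Process.preWienerMeasure]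
        {ω | Disjoint (ball (φ sleTestCentre) (2 * (R / 3))) (Γ ω).range} := by
      filter_upwards [hae, h₆ h8 h8'] with ω ⟨_, c, hc, hci⟩ hsimple
      intro hdisj
      show Disjoint (ball (φ sleTestCentre) (2 * (R / 3))) (Γ ω).range
      rw [hc, CurveClass.range_mk]
      refine Set.disjoint_left.2 fun w hw hwc => ?_
      -- `w = φ v` with `v ∈ V ⊆ B ∩ ℍ`
      have hwS : w ∈ S := hRS (ball_subset_ball (by linarith) hw)
      have hwD : w ∈ D.carrier := hwS.1
      have hv : φ.symm w ∈ V := hwS.2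
      have hwv : φ (φ.symm w) = w := φ.apply_symm_apply hwD
      -- the points of the compactified image
      obtain ⟨s, hs⟩ := hwc
      by_cases hs1 : (s : ℝ) < 1
      · rw [hci.1 s hs1] at hs
        rcases eq_or_ne (rayParam s) 0 with ht | ht
        · rw [ht, sleTrace_zero, hφ.boundaryExtension_zero] at hs
          exact D.pt_notMem_carrier 0 (hs ▸ hwD)
        · have ht' : 0 < rayParam s := pos_iff_ne_zero.2 ht
          have hH : sleTrace ((8 : ℝ≥0) / 3) ω (rayParam s) ∈ upperHalfPlaneSet := hsimple.2 _ ht'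
          rw [φ.boundaryExtension_eq hH] at hs
          have heq : sleTrace ((8 : ℝ≥0) / 3) ω (rayParam s) = φ.symm w :=
            φ.injOn hH (hVH hv) (hs.trans hwv.symm)
          exact Set.disjoint_left.1 hdisj (mem_range_self _) (heq ▸ hVA hv)
      · have hs' : s = 1 := unitInterval.eq_one_of_not_lt hs1
        rw [hs', hci.2] at hs
        exact D.pt_notMem_carrier 1 (hs ▸ hwD)
    intro h0
    exact measure_disjoint_sleTrace_ellHull_ne_zero h61 (measure_mono_null_ae key h0)

end Literature.Probability.RandomPlanarGeometry
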